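import Mathlib.AlgebraicGeometry.Morphisms.ClosedImmersion
import Mathlib.CategoryTheory.MorphismProperty.Limits
import Mathlib.RingTheory.WittVector.Teichmuller
import Literature.AlgebraicGeometry.Motives.CrystallineRealization
import HarnessLib

/-!
# The special fibre of a `W(k)`-scheme is a closed subscheme of each thickening

For a prime `p`, a field `k` of characteristic `p` and a `W(k)`-scheme `𝒳`, the comparison map
`specialFibreToThickening 𝒳 n : X_k ⟶ X_{n+1}` from the special fibre `X_k = 𝒳 ×_W Spec k` to the
thickening `X_{n+1} = 𝒳 ×_W Spec (W/pⁿ⁺¹)` is a closed immersion: it is `pullback.map` of the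
identity of `𝒳` and of `Spec (W/pⁿ⁺¹ → k)`, the latter a closed immersion because the residue map
`W/pⁿ⁺¹ → k` is surjective (Teichmüller section of `W(k) → k`, Mathlib
`WittVector.constantCoeff_surjective`), and closed immersions are stable under base change and
composition (Mathlib `MorphismProperty.pullbackMap`).

This is stub G2 (`stub_specialFibreToThickening_closedImmersion`) of line
`sigma-ob-kzero-additivity` of the crux `PadicPridhamSemiregularity` (route `PadicSemiregularLift`
of `HodgeConjecture`): pure tower geometry, valid for every `W(k)`-scheme.
-/

noncomputable section

set_option linter.dupNamespace false

open CategoryTheory CategoryTheory.Limits AlgebraicGeometry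
  Literature.AlgebraicGeometry.Motives Literature.AlgebraicGeometry.Motives.WittScheme

namespace Summit.HodgeConjecture.HodgeConjecture.Theorems.PadicPridhamSemiregularity

/-- The residue map `W_{n+1} = W(k)/pⁿ⁺¹ → k` is surjective (it is induced by the surjection
`W(k) → k`, which has the Teichmüller section). [folklore] -/
theorem wittQuotToResidue_surjective (p : ℕ) [Fact p.Prime] (k : Type*) [CommRing k] [CharP k p]
    (n : ℕ) : Function.Surjective (wittQuotToResidue p k n) :=
  Ideal.Quotient.lift_surjective_of_surjective _ _ (WittVector.constantCoeff_surjective p)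

/-- `Spec k ⟶ Spec W_{n+1}`, the map induced by the residue map `W_{n+1} → k`, is a closed
immersion (Mathlib `IsClosedImmersion.spec_of_surjective`). [folklore] -/
theorem isClosedImmersion_specMap_wittQuotToResidue (p : ℕ) [Fact p.Prime] (k : Type*)
    [CommRing k] [CharP k p] (n : ℕ) :
    IsClosedImmersion (Spec.map (CommRingCat.ofHom (wittQuotToResidue p k n))) :=
  IsClosedImmersion.spec_of_surjective _ (wittQuotToResidue_surjective p k n)

/-- Stub G2 of line `sigma-ob-kzero-additivity`: for every `W(k)`-scheme `𝒳` and every `n`, the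
map `X_k ⟶ X_{n+1}` from the special fibre to the `(n+1)`-st thickening is a closed immersion
(base change of the closed immersion `Spec k ⟶ Spec W_{n+1}` composed with an identity;
Mathlib `MorphismProperty.pullbackMap` for `P = IsClosedImmersion`). [folklore] -/
theorem stub_specialFibreToThickening_closedImmersion :
  ∀ (p : ℕ) [Fact p.Prime] (k : Type) [Field k] [CharP k p] (𝒳 : SchemeOver (WittVector p k)) (n : ℕ),
    IsClosedImmersion (specialFibreToThickening 𝒳 n) := by
  intro p _ k _ _ 𝒳 n
  exact MorphismProperty.pullbackMap (P := @IsClosedImmersion) inferInstance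
    (isClosedImmersion_specMap_wittQuotToResidue p k n) (Category.id_comp _).symm
    (by rw [← Spec.map_comp, ← CommRingCat.ofHom_comp, wittQuotToResidue_comp_algebraMap])

end Summit.HodgeConjecture.HodgeConjecture.Theorems.PadicPridhamSemiregularity

end
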